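import Mathlib
import Summits.Ventures.PercRepro2.MixChordSupportClasses
import Summits.Ventures.PercRepro2.MixChordORootEdgeClosureAll
import Summits.Ventures.PercRepro2.MixChordOLeafRootMirror

/-!
# The `o`-class `D`-chord on the TWO-ROOT STAR: `a₃` adjacent (with positive weight) only to the two roots
(blind cell PercRepro2, night-1 g23; proofs/NIGHT1-G23.md §5)

`a₃` carries the root edges `e = {a₃, a₁}` (weight `t`) and `g = {a₃, a₂}` (weight `r`) and nothing else of
positive weight.  The chord along the `o`-edge `f = {o, a₁}` follows from the root-edge closure
`dChord_of_update_zero` (p551317) at `e`: its hypothesis `0 ≤ S` holds on this class by an EXACT identity,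
and the chord at `p[e ↦ 0]` is the leaf-at-`a₂` class in the support graph (MixChordSupportClasses.lean).

* **`prob_update_one_eq_star`** (the pinned-open root edge): for an event `A ⊆ Q` built from connections
  among `a₁, a₂, o, b`, `P_{p[e ↦ 1]}(A) = (1 − r)·P_{p[e ↦ 0]}(A)` — pin `g` (both root edges open kill
  `Q`), then delete `g` and `e` by the support transport, where `A` is free of the single leaf edge
  (typer-1's `free_connEvent`).
* **`Scales p ends o a₁ a₂ b e c`** — the six `Q`-masses of the closure at `p[e ↦ 1]` are `c` times those at
  `p[e ↦ 0]` — and **`sClosure_of_scales`**: `S = c³·D₀D₀⁰Q₀²Q₀⁰²·[J′(p₀) − (1 − q)J′(p₀⁰)]` with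
  `p₀ = p[e ↦ 0]` (`df = 0`, `g₁ = c²J′(p₀)`), hence **`dChord_of_update_zero_of_scales`**: the closure
  at `e` is UNCONDITIONAL on every class that scales (`0 ≤ S` by the `J′`-chord `j'Chord`).
* The two-root star scales by `c = 1 − r` (`scales_star`): **`dChord_o_edge_of_two_root_star`**,
  the mirror `dChord_o_edge₂_of_two_root_star`, and the chain's rows `dz2Chord_o_edge_of_two_root_star` /
  `dz2Chord_o_edge₂_of_two_root_star`.

Own code; standard axioms.
-/

namespace Summit.Ventures.PercRepro2

open UnionCluster CovForm

namespace Mix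

namespace Star

open Support

section FreeUpdate

variable {E : Type*} [Fintype E] [DecidableEq E] {R : Type*} [Field R] [LinearOrder R]
  [IsStrictOrderedRing R]

/-- The probability of an event free of `e` does not see the weight of `e`: pinned open = pinned closed. -/
lemma prob_update_one_eq_update_zero_of_free (p : E → R) {e : E} {A : Set (Config E)}
    (hA : PendantRoot.Free e A) :
    prob (Function.update p e 1) A = prob (Function.update p e 0) A := by
  set p' : E → R := Function.update p e (1 / 2 : R) with hp'
  have hp'e : p' e = 1 / 2 := by simp [hp']
  have h0 := PendantRoot.prob_inter_closedEdge_of_free p' hA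
  rw [prob_inter_closedEdge, hp'e, hp', Function.update_idem] at h0
  have h1 := PendantRoot.prob_inter_openEdge_of_free p' hA
  rw [prob_inter_openEdge, hp'e, hp', Function.update_idem] at h1
  have h2 : (1 : R) - 1 / 2 = 1 / 2 := by norm_num
  rw [h2] at h0
  have hne : (1 / 2 : R) ≠ 0 := by norm_num
  have e0 := mul_left_cancel₀ hne (h0.trans (mul_comm _ _))
  have e1 := mul_left_cancel₀ hne (h1.trans (mul_comm _ _))
  rw [e0, e1]

/-- The probability of an event free of `e` is the probability with `e` pinned closed. -/
lemma prob_update_zero_eq_of_free (p : E → R) {e : E} {A : Set (Config E)}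
    (hA : PendantRoot.Free e A) : prob (Function.update p e 0) A = prob p A := by
  rw [prob_eq_pin p A e, prob_update_one_eq_update_zero_of_free p hA]
  ring

end FreeUpdate

section Star

variable {V : Type*} {E : Type*} [Fintype E] [DecidableEq E] [DecidableEq V] {R : Type*} [Field R]
  [LinearOrder R] [IsStrictOrderedRing R]

variable (p : E → R) (ends : E → Sym2 V) {a₁ a₂ a₃ : V} {e g : E}

omit [DecidableEq E] [DecidableEq V] in
/-- The other root edge is not in the leaf support of the first. -/
lemma other_not_mem_leafSupport (hg : ends g = s(a₃, a₂)) (heg : e ≠ g) :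
    g ∉ leafSupport ends a₃ e := by
  rw [mem_leafSupport, not_not]
  exact ⟨by rw [hg]; exact Sym2.mem_mk_left _ _, heg.symm⟩

omit [Fintype E] [DecidableEq V] [Field R] [LinearOrder R] [IsStrictOrderedRing R] in
/-- Restricting after pinning an edge off `S` is restricting. -/
lemma restrict_update_of_not_mem (S : Finset E) (q : E → R) {h : E} (hh : h ∉ S) (c : R) :
    Support.restrict S (Function.update q h c) = Support.restrict S q := by
  funext e'
  have : (e' : E) ≠ h := fun he => hh (he ▸ e'.2)
  simp [Support.restrict, Function.update_of_ne this]

omit [DecidableEq V] in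
/-- In the leaf support of `h` (an edge `{a₃, x}`), a connection between vertices other than `a₃` is free
of `h`. -/
lemma free_restrict_connEvent {h : E} {x : V} (hh : ends h = s(a₃, x)) (h3x : a₃ ≠ x) {u v : V}
    (hu : u ≠ a₃) (hv : v ≠ a₃) :
    PendantRoot.Free (⟨h, self_mem_leafSupport ends⟩ : {e' // e' ∈ leafSupport ends a₃ h})
      (ext (leafSupport ends a₃ h) ⁻¹' connEvent ends u v) := by
  rw [preimage_connEvent]
  exact PendantRoot.free_connEvent (show restrictEnds (leafSupport ends a₃ h) ends ⟨h, _⟩ = s(a₃, x) from hh)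
    (leaf_restrict ends _) h3x hu hv

/-- `Q` is free of the leaf edge in its leaf support. -/
lemma free_restrict_Q {h : E} {x : V} (hh : ends h = s(a₃, x)) (h3x : a₃ ≠ x) (h31 : a₃ ≠ a₁)
    (h32 : a₃ ≠ a₂) :
    PendantRoot.Free (⟨h, self_mem_leafSupport ends⟩ : {e' // e' ∈ leafSupport ends a₃ h})
      (ext (leafSupport ends a₃ h) ⁻¹' avoidAll ends a₂ {a₁}) := by
  rw [preimage_avoidAll, PendantRoot.avoidAll_eq_compl]
  exact (PendantRoot.free_connEvent
    (show restrictEnds (leafSupport ends a₃ h) ends ⟨h, _⟩ = s(a₃, x) from hh)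
    (leaf_restrict ends _) h3x h31.symm h32.symm).compl

omit [Fintype E] [DecidableEq E] [DecidableEq V] in
/-- Both root edges open join the roots. -/
lemma conn_roots_of_open (he : ends e = s(a₃, a₁)) (hg : ends g = s(a₃, a₂)) {ω : Config E}
    (hωe : ω e = true) (hωg : ω g = true) : Conn ends ω a₂ a₁ :=
  conn_trans (conn_symm (conn_of_openAdj ⟨g, hωg, hg⟩)) (conn_of_openAdj ⟨e, hωe, he⟩)

omit [DecidableEq V] in
/-- **The pinned-open root edge of a two-root star**: for an event `A ⊆ Q` free of the leaf edge in both
leaf supports, `P_{p[e ↦ 1]}(A) = (1 − p g)·P_{p[e ↦ 0]}(A)`. -/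
theorem prob_update_one_eq_star (he : ends e = s(a₃, a₁)) (hg : ends g = s(a₃, a₂)) (heg : e ≠ g)
    (hstar : ∀ e', a₃ ∈ ends e' → e' ≠ e → e' ≠ g → p e' = 0)
    {A : Set (Config E)} (hAQ : A ⊆ avoidAll ends a₂ {a₁})
    (hAe : PendantRoot.Free (⟨e, self_mem_leafSupport ends⟩ : {e' // e' ∈ leafSupport ends a₃ e})
      (ext (leafSupport ends a₃ e) ⁻¹' A))
    (hAg : PendantRoot.Free (⟨g, self_mem_leafSupport ends⟩ : {e' // e' ∈ leafSupport ends a₃ g})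
      (ext (leafSupport ends a₃ g) ⁻¹' A)) :
    prob (Function.update p e 1) A = (1 - p g) * prob (Function.update p e 0) A := by
  classical
  -- pin `g` at `p[e ↦ 1]`
  rw [prob_eq_pin (Function.update p e 1) A g, Function.update_of_ne heg.symm]
  -- both root edges open: `A ⊆ Q` is impossible
  have hzero : prob (Function.update (Function.update p e 1) g 1) A = 0 := by
    rw [← prob_update_one_inter_openEdge, Function.update_comm heg, ← prob_update_one_inter_openEdge]
    have : (A ∩ openEdge g) ∩ openEdge e = ∅ := by
      ext ω
      simp only [Set.mem_inter_iff, mem_openEdge, Set.mem_empty_iff_false, iff_false, not_and]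
      rintro ⟨hA, hg'⟩ he'
      have hQ := hAQ hA
      exact hQ a₁ (Finset.mem_singleton_self _) (conn_roots_of_open ends he hg he' hg')
    rw [this, prob_empty]
  rw [hzero, mul_zero, zero_add]
  congr 1
  -- delete `g` (weight 0) and compare the two pins of `e` in the leaf support of `e`
  have hgS : g ∉ leafSupport ends a₃ e := other_not_mem_leafSupport ends hg heg
  have heS' : e ∉ leafSupport ends a₃ g := other_not_mem_leafSupport ends he heg.symm
  have hS1 : ∀ e', e' ∉ leafSupport ends a₃ e → Function.update (Function.update p e 1) g 0 e' = 0 := by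
    intro e' he'
    rw [mem_leafSupport, not_not] at he'
    by_cases hg' : e' = g
    · subst hg'; simp
    · rw [Function.update_of_ne hg', Function.update_of_ne he'.2]
      exact hstar e' he'.1 he'.2 hg'
  have hS0 : ∀ e', e' ∉ leafSupport ends a₃ e → Function.update (Function.update p e 0) g 0 e' = 0 := by
    intro e' he'
    rw [mem_leafSupport, not_not] at he'
    by_cases hg' : e' = g
    · subst hg'; simp
    · rw [Function.update_of_ne hg', Function.update_of_ne he'.2]
      exact hstar e' he'.1 he'.2 hg'
  have step1 : prob (Function.update (Function.update p e 1) g 0) A =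
      prob (Function.update (Function.update p e 0) g 0) A := by
    rw [prob_restrict _ hS1 A, prob_restrict _ hS0 A, restrict_update_of_not_mem _ _ hgS,
      restrict_update_of_not_mem _ _ hgS, restrict_update _ _ (self_mem_leafSupport ends),
      restrict_update _ _ (self_mem_leafSupport ends)]
    exact prob_update_one_eq_update_zero_of_free _ hAe
  -- delete `e` (weight 0) and unpin `g` in the leaf support of `g`
  have hS0' : ∀ e', e' ∉ leafSupport ends a₃ g → Function.update p e 0 e' = 0 := by
    intro e' he'
    rw [mem_leafSupport, not_not] at he'
    by_cases he'' : e' = e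
    · subst he''; simp
    · rw [Function.update_of_ne he'']
      exact hstar e' he'.1 he'' he'.2
  have hS00' : ∀ e', e' ∉ leafSupport ends a₃ g → Function.update (Function.update p e 0) g 0 e' = 0 :=
    update_zero_off _ hS0' (self_mem_leafSupport ends) 0
  have step2 : prob (Function.update (Function.update p e 0) g 0) A = prob (Function.update p e 0) A := by
    rw [prob_restrict _ hS00' A, prob_restrict _ hS0' A, restrict_update _ _ (self_mem_leafSupport ends)]
    exact prob_update_zero_eq_of_free _ hAg
  rw [step1, step2]

end Star

section Identity

variable {V : Type*} {E : Type*} [Fintype E] [DecidableEq E] [Fintype V] [DecidableEq V]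
  {R : Type*} [Field R] [LinearOrder R] [IsStrictOrderedRing R]

variable (p : E → R) (ends : E → Sym2 V) (o a₁ a₂ a₃ b : V) (e g f : E)

/-- The `J′` functional of an instance (the `g₁` piece unpinned). -/
noncomputable def jPrime (q : E → R) : R :=
  2 * PendantRoot.covC q ends a₁ a₂ (connEvent ends a₂ o) (connEvent ends a₂ b) -
    2 * PendantRoot.covC q ends a₁ a₂ (connEvent ends a₂ o) (connEvent ends a₁ b)

/-- **The scaling property at a root edge `e`**: the six `Q`-masses of the root-edge closure at `p[e ↦ 1]`
are `c` times those at `p[e ↦ 0]` (`Q`, `Q ∩ oH`, `Q ∩ bL`, `Q ∩ bH`, `Q ∩ oH ∩ bL`, `Q ∩ oH ∩ bH`). -/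
def Scales (c : R) : Prop :=
  prob (Function.update p e 1) (avoidAll ends a₂ {a₁}) =
      c * prob (Function.update p e 0) (avoidAll ends a₂ {a₁}) ∧
    prob (Function.update p e 1) (avoidAll ends a₂ {a₁} ∩ connEvent ends a₂ o) =
      c * prob (Function.update p e 0) (avoidAll ends a₂ {a₁} ∩ connEvent ends a₂ o) ∧
    prob (Function.update p e 1) (avoidAll ends a₂ {a₁} ∩ connEvent ends a₁ b) =
      c * prob (Function.update p e 0) (avoidAll ends a₂ {a₁} ∩ connEvent ends a₁ b) ∧
    prob (Function.update p e 1) (avoidAll ends a₂ {a₁} ∩ connEvent ends a₂ b) =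
      c * prob (Function.update p e 0) (avoidAll ends a₂ {a₁} ∩ connEvent ends a₂ b) ∧
    prob (Function.update p e 1) (avoidAll ends a₂ {a₁} ∩ (connEvent ends a₂ o ∩ connEvent ends a₁ b)) =
      c * prob (Function.update p e 0) (avoidAll ends a₂ {a₁} ∩ (connEvent ends a₂ o ∩ connEvent ends a₁ b)) ∧
    prob (Function.update p e 1) (avoidAll ends a₂ {a₁} ∩ (connEvent ends a₂ o ∩ connEvent ends a₂ b)) =
      c * prob (Function.update p e 0) (avoidAll ends a₂ {a₁} ∩ (connEvent ends a₂ o ∩ connEvent ends a₂ b))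

variable {p ends o a₁ a₂ a₃ b e g f}

omit [Fintype V] [DecidableEq V] [LinearOrder R] [IsStrictOrderedRing R] in
/-- Under the scaling property, `g₁ = c²·J′(p[e ↦ 0])` and `df = 0`. -/
lemma pieces_of_scales {c : R} (h : Scales p ends o a₁ a₂ b e c) :
    g1C p ends o a₁ a₂ b e = c ^ 2 * jPrime ends o a₁ a₂ b (Function.update p e 0) ∧
      dfC p ends a₁ a₂ b e = 0 := by
  obtain ⟨h1, h2, h3, h4, h5, h6⟩ := h
  refine ⟨?_, ?_⟩
  · unfold g1C jPrime PendantRoot.covC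
    rw [h1, h2, h3, h4, h5, h6]
    ring
  · unfold dfC
    rw [h1, h3, h4]
    ring

omit [Fintype V] [DecidableEq V] [LinearOrder R] [IsStrictOrderedRing R] in
/-- **`S` under the scaling property** (at `p` and at `p[f ↦ 0]`, with the same factor `c`):
`S = c³·D₀D₀⁰Q₀²Q₀⁰²·[J′(p₀) − (1 − q)J′(p₀⁰)]`. -/
theorem sClosure_of_scales {c : R} (h : Scales p ends o a₁ a₂ b e c)
    (h0 : Scales (Function.update p f 0) ends o a₁ a₂ b e c) :
    SClosure p ends o a₁ a₂ a₃ b e f =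
      c ^ 3 *
        (prob (Function.update p e 0) (PDEvent ends a₁ a₂ a₃) *
          prob (Function.update (Function.update p f 0) e 0) (PDEvent ends a₁ a₂ a₃) *
          prob (Function.update p e 0) (avoidAll ends a₂ {a₁}) ^ 2 *
          prob (Function.update (Function.update p f 0) e 0) (avoidAll ends a₂ {a₁}) ^ 2) *
        (jPrime ends o a₁ a₂ b (Function.update p e 0) -
          (1 - p f) * jPrime ends o a₁ a₂ b (Function.update (Function.update p f 0) e 0)) := by
  obtain ⟨hg1, hdf⟩ := pieces_of_scales h
  obtain ⟨hg10, hdf0⟩ := pieces_of_scales h0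
  have hQ := h.1
  have hQ0 := h0.1
  unfold SClosure
  rw [hQ, hQ0, hg1, hg10, hdf, hdf0]
  ring

omit [Fintype V] [DecidableEq V] in
/-- **The root-edge closure under the scaling property**: for `e = {a₁, a₃}` and `f = {o, a₁}`, if the six
`Q`-masses scale by the same `c ≥ 0` at `p` and at `p[f ↦ 0]`, the `D`-chord at `p[e ↦ 0]` gives the
`D`-chord at `p` (the hypothesis `0 ≤ S` of `dChord_of_update_zero` holds by the `J′`-chord). -/
theorem dChord_of_update_zero_of_scales (hp : IsProbVec p) (hends : ends e = s(a₁, a₃))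
    (hf : ends f = s(o, a₁)) (hef : e ≠ f) {c : R} (hc : 0 ≤ c) (h : Scales p ends o a₁ a₂ b e c)
    (h0s : Scales (Function.update p f 0) ends o a₁ a₂ b e c)
    (h0 : NMixChord (normD ends a₁ a₂ a₃) (Function.update p e 0) ends o a₁ a₂ a₃ b f) :
    NMixChord (normD ends a₁ a₂ a₃) p ends o a₁ a₂ a₃ b f := by
  refine dChord_of_update_zero p ends b hp hends hf hef ?_ h0
  rw [sClosure_of_scales h h0s]
  have hp0 : IsProbVec (Function.update p e 0) := hp.update e le_rfl zero_le_one
  have hJ := j'Chord (Function.update p e 0) ends (a₂ := a₂) b hp0 hf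
  rw [Function.update_of_ne hef.symm, Function.update_comm hef] at hJ
  have hpf : IsProbVec (Function.update p f 0) := hp.update f le_rfl zero_le_one
  have hD0 := prob_nonneg hp0 (PDEvent ends a₁ a₂ a₃)
  have hD00 := prob_nonneg (hpf.update e le_rfl zero_le_one) (PDEvent ends a₁ a₂ a₃)
  refine mul_nonneg (mul_nonneg (pow_nonneg hc 3)
    (mul_nonneg (mul_nonneg (mul_nonneg hD0 hD00) (sq_nonneg _)) (sq_nonneg _))) ?_
  unfold jPrime
  linarith

omit [Fintype V] in
/-- **A two-root star scales by `1 − r`** (`r` the weight of the other root edge `g`). -/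
lemma scales_star (he : ends e = s(a₃, a₁)) (hg : ends g = s(a₃, a₂)) (heg : e ≠ g)
    (hstar : ∀ e', a₃ ∈ ends e' → e' ≠ e → e' ≠ g → p e' = 0) (h31 : a₃ ≠ a₁) (h32 : a₃ ≠ a₂)
    (ho : o ≠ a₃) (hb : b ≠ a₃) : Scales p ends o a₁ a₂ b e (1 - p g) := by
  have hQe : PendantRoot.Free (⟨e, self_mem_leafSupport ends⟩ : {e' // e' ∈ leafSupport ends a₃ e})
      (ext (leafSupport ends a₃ e) ⁻¹' avoidAll ends a₂ {a₁}) := free_restrict_Q ends he h31 h31 h32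
  have hQg : PendantRoot.Free (⟨g, self_mem_leafSupport ends⟩ : {e' // e' ∈ leafSupport ends a₃ g})
      (ext (leafSupport ends a₃ g) ⁻¹' avoidAll ends a₂ {a₁}) := free_restrict_Q ends hg h32 h31 h32
  have hce : ∀ u v : V, u ≠ a₃ → v ≠ a₃ → PendantRoot.Free (⟨e, self_mem_leafSupport ends⟩ :
      {e' // e' ∈ leafSupport ends a₃ e}) (ext (leafSupport ends a₃ e) ⁻¹' connEvent ends u v) :=
    fun u v hu hv => free_restrict_connEvent ends he h31 hu hv
  have hcg : ∀ u v : V, u ≠ a₃ → v ≠ a₃ → PendantRoot.Free (⟨g, self_mem_leafSupport ends⟩ :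
      {e' // e' ∈ leafSupport ends a₃ g}) (ext (leafSupport ends a₃ g) ⁻¹' connEvent ends u v) :=
    fun u v hu hv => free_restrict_connEvent ends hg h32 hu hv
  have h1 := h31.symm
  have h2 := h32.symm
  refine ⟨?_, ?_, ?_, ?_, ?_, ?_⟩
  · exact prob_update_one_eq_star p ends he hg heg hstar subset_rfl hQe hQg
  · refine prob_update_one_eq_star p ends he hg heg hstar Set.inter_subset_left ?_ ?_
    · rw [Set.preimage_inter]; exact hQe.inter (hce _ _ h2 ho)
    · rw [Set.preimage_inter]; exact hQg.inter (hcg _ _ h2 ho)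
  · refine prob_update_one_eq_star p ends he hg heg hstar Set.inter_subset_left ?_ ?_
    · rw [Set.preimage_inter]; exact hQe.inter (hce _ _ h1 hb)
    · rw [Set.preimage_inter]; exact hQg.inter (hcg _ _ h1 hb)
  · refine prob_update_one_eq_star p ends he hg heg hstar Set.inter_subset_left ?_ ?_
    · rw [Set.preimage_inter]; exact hQe.inter (hce _ _ h2 hb)
    · rw [Set.preimage_inter]; exact hQg.inter (hcg _ _ h2 hb)
  · refine prob_update_one_eq_star p ends he hg heg hstar Set.inter_subset_left ?_ ?_
    · rw [Set.preimage_inter, Set.preimage_inter]; exact hQe.inter ((hce _ _ h2 ho).inter (hce _ _ h1 hb))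
    · rw [Set.preimage_inter, Set.preimage_inter]; exact hQg.inter ((hcg _ _ h2 ho).inter (hcg _ _ h1 hb))
  · refine prob_update_one_eq_star p ends he hg heg hstar Set.inter_subset_left ?_ ?_
    · rw [Set.preimage_inter, Set.preimage_inter]; exact hQe.inter ((hce _ _ h2 ho).inter (hce _ _ h2 hb))
    · rw [Set.preimage_inter, Set.preimage_inter]; exact hQg.inter ((hcg _ _ h2 ho).inter (hcg _ _ h2 hb))

end Identity

section Theorem

variable {V : Type*} {E : Type*} [Fintype E] [DecidableEq E] [Fintype V] [DecidableEq V]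
  {R : Type*} [Field R] [LinearOrder R] [IsStrictOrderedRing R]

variable (p : E → R) (ends : E → Sym2 V) {o a₁ a₂ a₃ : V} (b : V) {e g f : E}

omit [Fintype E] [DecidableEq E] [Fintype V] [DecidableEq V] [LinearOrder R] [IsStrictOrderedRing R] in
/-- A root edge of `a₃` is not the `o`-edge. -/
lemma root_ne_o_edge {x : V} (hf : ends f = s(o, a₁)) (he : ends e = s(a₃, x)) (ho : o ≠ a₃) (h31 : a₃ ≠ a₁) :
    e ≠ f := by
  rintro rfl
  rw [hf] at he
  have : a₃ ∈ s(o, a₁) := by rw [he]; exact Sym2.mem_mk_left _ _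
  rw [Sym2.mem_iff] at this
  rcases this with h | h
  · exact ho h.symm
  · exact h31 h

/-- **THE `o`-CLASS `D`-CHORD ON THE TWO-ROOT STAR**: `a₃` adjacent with positive weight only to the two
roots (`e = {a₃, a₁}`, `g = {a₃, a₂}`, every other edge at `a₃` of weight `0`), any weights. -/
theorem dChord_o_edge_of_two_root_star (hp : IsProbVec p) (hf : ends f = s(o, a₁))
    (he : ends e = s(a₃, a₁)) (hg : ends g = s(a₃, a₂)) (heg : e ≠ g)
    (hstar : ∀ e', a₃ ∈ ends e' → e' ≠ e → e' ≠ g → p e' = 0)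
    (h31 : a₃ ≠ a₁) (h32 : a₃ ≠ a₂) (ho : o ≠ a₃) (hb : b ≠ a₃) :
    NMixChord (normD ends a₁ a₂ a₃) p ends o a₁ a₂ a₃ b f := by
  have hef : e ≠ f := root_ne_o_edge ends hf he ho h31
  have hgf : g ≠ f := root_ne_o_edge ends hf hg ho h31
  have hends : ends e = s(a₁, a₃) := by rw [he, Sym2.eq_swap]
  have hstar0 : ∀ e', a₃ ∈ ends e' → e' ≠ e → e' ≠ g → Function.update p f 0 e' = 0 := by
    intro e' h3 hne hng
    have hef' : e' ≠ f := by
      rintro rfl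
      rw [hf, Sym2.mem_iff] at h3
      rcases h3 with h | h
      · exact ho h.symm
      · exact h31 h
    rw [Function.update_of_ne hef']
    exact hstar e' h3 hne hng
  have hs0 := scales_star (p := Function.update p f 0) he hg heg hstar0 h31 h32 ho hb
  rw [Function.update_of_ne hgf] at hs0
  refine dChord_of_update_zero_of_scales hp hends hf hef (sub_nonneg.2 (hp.le_one g))
    (scales_star he hg heg hstar h31 h32 ho hb) hs0 ?_
  -- the chord at `p[e ↦ 0]`: `a₃` a leaf at `a₂` in the support graph
  refine dChord_o_edge_of_leaf_either_root_support (Function.update p e 0) ends b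
    (hp.update e le_rfl zero_le_one) hf (g := g) (Or.inl hg) ?_ h32 h31 ho hb
  intro e' h3 hne
  by_cases hee : e' = e
  · subst hee; simp
  · rw [Function.update_of_ne hee]
    exact hstar e' h3 hee hne

/-- **The chain's row on the two-root star** (`(D·Z)²`-chord along `{o, a₁}`). -/
theorem dz2Chord_o_edge_of_two_root_star (hp : IsProbVec p) (hf : ends f = s(o, a₁))
    (he : ends e = s(a₃, a₁)) (hg : ends g = s(a₃, a₂)) (heg : e ≠ g)
    (hstar : ∀ e', a₃ ∈ ends e' → e' ≠ e → e' ≠ g → p e' = 0)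
    (h31 : a₃ ≠ a₁) (h32 : a₃ ≠ a₂) (ho : o ≠ a₃) (hb : b ≠ a₃)
    (h0 : HCov (Function.update p f 0) ends o a₁ a₂ a₃ b) :
    NMixChord (normDZ2 ends a₁ a₂ a₃) p ends o a₁ a₂ a₃ b f :=
  nMixChord_DZ2_of_D hp (dChord_o_edge_of_two_root_star p ends b hp hf he hg heg hstar h31 h32 ho hb) h0

/-- **The two-root star along the other `o`-edge `f = {o, a₂}`** (root swap). -/
theorem dChord_o_edge₂_of_two_root_star (hp : IsProbVec p) (hf : ends f = s(o, a₂))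
    (he : ends e = s(a₃, a₁)) (hg : ends g = s(a₃, a₂)) (heg : e ≠ g)
    (hstar : ∀ e', a₃ ∈ ends e' → e' ≠ e → e' ≠ g → p e' = 0)
    (h31 : a₃ ≠ a₁) (h32 : a₃ ≠ a₂) (ho : o ≠ a₃) (hb : b ≠ a₃) :
    NMixChord (normD ends a₁ a₂ a₃) p ends o a₁ a₂ a₃ b f :=
  (nMixChord_normD_root_swap p ends b o a₁ a₂ a₃ f).1
    (dChord_o_edge_of_two_root_star p ends b hp hf hg he heg.symm
      (fun e' h3 hne hng => hstar e' h3 hng hne) h32 h31 ho hb)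

/-- **The chain's row on the two-root star along `{o, a₂}`.** -/
theorem dz2Chord_o_edge₂_of_two_root_star (hp : IsProbVec p) (hf : ends f = s(o, a₂))
    (he : ends e = s(a₃, a₁)) (hg : ends g = s(a₃, a₂)) (heg : e ≠ g)
    (hstar : ∀ e', a₃ ∈ ends e' → e' ≠ e → e' ≠ g → p e' = 0)
    (h31 : a₃ ≠ a₁) (h32 : a₃ ≠ a₂) (ho : o ≠ a₃) (hb : b ≠ a₃)
    (h0 : HCov (Function.update p f 0) ends o a₁ a₂ a₃ b) :
    NMixChord (normDZ2 ends a₁ a₂ a₃) p ends o a₁ a₂ a₃ b f :=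
  nMixChord_DZ2_of_D hp (dChord_o_edge₂_of_two_root_star p ends b hp hf he hg heg hstar h31 h32 ho hb) h0

end Theorem

end Star

end Mix

end Summit.Ventures.PercRepro2
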